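import Summits.BirchSwinnertonDyer.BirchSwinnertonDyer.Theorems.ByReductionTypeAtTwoFineSelmerConjAAtTwoAdditivePotGoodNarrowRankCertificate316LayerOneDyadic
import HarnessLib

/-!
# Route `ByReductionTypeAtTwo` (rung K4), crux C1″ `FineSelmerConjAAtTwoAdditivePotGood` (item stmt-BirchSwinnertonDyer-22615):
# THE LAYER-`1` FIELD `A₁ = ℚ(θ, √2)` OF THE CUBIC FIELD OF DISCRIMINANT `316`, PART C — dyadic RESIDUES: the unit `ε = 3 + θ − θ²` is NOT a
# norm from `A₁(√(2+√2))`, and the totally positive unit `u₊ = (−1 + 2θ + 2θ²) + √2(−1 + 2θ + θ²)` is NOT a square, nor is `u₊(2 + √2)`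
# (KERNEL; a `--supports 22615` file; seat `bsd-2adic-k4-w1` GEN 11; sequel of `…316LayerOneDyadic`; row `261648q1`, narrow-rank certificate
# one layer up)

HONEST FRAMING (cell `bsd-2adic`, D-0036/D-0054/D-0152): KERNEL theorems about ONE totally real sextic field; no elliptic curve, no named fact,
no `sorry`, no definition. Closes nothing at the `∀`-level; nothing booked; BSD is not proved by any of this.

With `ξ = √2/θ` (prime, `e((ξ)|2) = 2`, `f = 1`, `2 = ξ²θ²`, residues `{0,1}` — `layer_one_dyadic_d316`) and the tree's `e = 2` dyadic lemma
(`Literature/…/DyadicUnitSquaresRamifiedPrime`, this seat): `ε − 1 = ξ⁴(θ − 2θ²)` with `θ − 2θ² ≡ 1 (mod ξ)`, so `ξ⁴ ‖ ε − 1` and `ε ≠ x² − ξμ·y²`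
(`ξμ = 2 + √2`) for `x, y ∈ A₁` — the non-norm unit of Chevalley's formula for `A₂ = A₁(√(2+√2))/A₁` (next files); `u₊ − 1 = ξ²(1 + ξλ₁)` and
`u₊ − (1 + ξ² + ξ³θ²) = ξ⁴(1 + ξλ₂)` put `u₊` in neither class of unit squares modulo `ξ⁵`, so `u₊` is not a square in `𝓞 A₁`; and `u₊(2 + √2) = u₊ξμ`
is not a square by `ξ`-adic parity (`ξ ∤ u₊μ`).

* `not_exists_sq_sub_mul_sq_eq_eps_sup_layer_one_d316` — `x² − (2 + √2)y² ≠ ε` on `A₁`.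
* `not_exists_sq_eq_uplus_sup_layer_one_d316` (integers), `not_exists_unit_sq_eq_uplus_sup_layer_one_d316` (units) — `u₊` is not a square.
* `not_exists_sq_eq_uplus_mul_sup_layer_one_d316` — `u₊(2 + √2)` is not a square of an integer of `A₁`.

References: [Omeara1963] §63A–B (63:1, 63:10); [NeukirchANT1999] Ch. V §3; [Washington1997] §13.1.
-/

set_option autoImplicit false
-- sibling precedent: the directory name repeats the summit name
set_option linter.dupNamespace false

noncomputable section

open scoped Classical IntermediateField NumberField nonZeroDivisors

namespace Summit.BirchSwinnertonDyer.BirchSwinnertonDyer.Theorems.AddKatoTwo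

open Polynomial IsDedekindDomain NumberField Field IntermediateField
  Literature.NumberTheory.EllipticCurves Literature.NumberTheory.EllipticCurves.ZpExtension
  Literature.NumberTheory.IwasawaTheory Literature.NumberTheory.NumberFields
  Literature.NumberTheory.GaloisRepresentations Literature.Geometry.Kaehler.ComplexTorus

variable {θ : AlgebraicClosure ℚ}

set_option maxHeartbeats 400000 in
/-- **`ε = 3 + θ − θ²` is NOT of the form `x² − (2 + √2)y²` with `x, y ∈ A₁ = ℚ(θ) ⊔ ℚ_1`** — it is not a norm from `A₁(√(2+√2))`, the second
cyclotomic layer: `2 + √2 = ξμ` with `ξ = √2/θ` prime (`e = 2`, `f = 1`), `ξ ∤ μ`, and `ξ⁴ ‖ ε − 1`; the tree's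
`not_exists_sq_sub_mul_sq_fractionRing_of_pow_four_dvd` (`(ε, 2+√2)_{(ξ)} = −1`). KERNEL. [cite: Omeara1963, §63B (63:10) and §63A (63:1)]
[cite: NeukirchANT1999, Ch. V §3] -/
theorem not_exists_sq_sub_mul_sq_eq_eps_sup_layer_one_d316
    (hθ : aeval θ (Cubic.toPoly ⟨1, ((-1 : ℤ) : ℚ), ((-4 : ℤ) : ℚ), ((2 : ℤ) : ℚ)⟩) = 0)
    {t : AlgebraicClosure ℚ} (ht : t ∈ (CyclotomicZp.zpExtension 2).layer 1) (ht2 : t ^ 2 = 2) :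
    ¬ ∃ x y : ↥(ℚ⟮θ⟯ ⊔ (CyclotomicZp.zpExtension 2).layer 1),
      x ^ 2 - (2 + ⟨t, (le_sup_right : (CyclotomicZp.zpExtension 2).layer 1 ≤ _) ht⟩) * y ^ 2 =
        inclusion (le_sup_left : ℚ⟮θ⟯ ≤ ℚ⟮θ⟯ ⊔ (CyclotomicZp.zpExtension 2).layer 1)
          (3 + AdjoinSimple.gen ℚ θ - AdjoinSimple.gen ℚ θ ^ 2) := by
  haveI : FiniteDimensional ℚ ↥ℚ⟮θ⟯ :=
    IntermediateField.adjoin.finiteDimensional ⟨_, Cubic.monic_of_a_eq_one', by rwa [← aeval_def]⟩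
  haveI : FiniteDimensional ℚ ↥((CyclotomicZp.zpExtension 2).layer 1) := (CyclotomicZp.zpExtension 2).finiteDimensional_layer_holds 1
  haveI : NumberField ↥ℚ⟮θ⟯ := NumberField.mk
  haveI : NumberField ↥(ℚ⟮θ⟯ ⊔ (CyclotomicZp.zpExtension 2).layer 1) := NumberField.mk
  obtain ⟨bA, xA, sA, -, hbAval, hsAval, -, RbA, RxA, hs, -, hprime, hres, hnb2, hnμ, -, -, -, -⟩ :=
    layer_one_dyadic_d316 hθ ht ht2
  obtain ⟨htwo, -, -, hxmu, heps, hlam, -, -, -, -, -, -, -, -⟩ := layer_one_ids_d316 bA xA RbA RxA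
  have h2 : (2 : 𝓞 ↥(ℚ⟮θ⟯ ⊔ (CyclotomicZp.zpExtension 2).layer 1)) = xA ^ 2 * bA ^ 2 := htwo.symm
  have h4 : xA ^ 4 ∣ (3 + bA - bA ^ 2) - 1 := ⟨_, heps⟩
  have h5 : ¬ xA ^ 5 ∣ (3 + bA - bA ^ 2) - 1 := by
    rintro ⟨c, hc⟩
    rw [heps, show xA ^ 5 * c = xA ^ 4 * (xA * c) by ring] at hc
    have hc' : bA - 2 * bA ^ 2 = xA * c := mul_left_cancel₀ (pow_ne_zero 4 hprime.ne_zero) hc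
    have h1 : xA ∣ 1 := ⟨c - (xA - 5 * bA ^ 2 * xA), by linear_combination hc' - hlam⟩
    exact hprime.not_unit (isUnit_of_dvd_one h1)
  have key := not_exists_sq_sub_mul_sq_fractionRing_of_pow_four_dvd (↥(ℚ⟮θ⟯ ⊔ (CyclotomicZp.zpExtension 2).layer 1))
    hprime h2 hnb2 hres hnμ h4 h5
  have hm : algebraMap (𝓞 ↥(ℚ⟮θ⟯ ⊔ (CyclotomicZp.zpExtension 2).layer 1)) ↥(ℚ⟮θ⟯ ⊔ (CyclotomicZp.zpExtension 2).layer 1)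
      (xA * (bA + bA ^ 2 * xA)) = 2 + ⟨t, (le_sup_right : (CyclotomicZp.zpExtension 2).layer 1 ≤ _) ht⟩ := by
    rw [hxmu, hs, ← hsAval]; push_cast; rfl
  have he : algebraMap (𝓞 ↥(ℚ⟮θ⟯ ⊔ (CyclotomicZp.zpExtension 2).layer 1)) ↥(ℚ⟮θ⟯ ⊔ (CyclotomicZp.zpExtension 2).layer 1)
      (3 + bA - bA ^ 2) = inclusion (le_sup_left : ℚ⟮θ⟯ ≤ ℚ⟮θ⟯ ⊔ (CyclotomicZp.zpExtension 2).layer 1)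
          (3 + AdjoinSimple.gen ℚ θ - AdjoinSimple.gen ℚ θ ^ 2) := by
    simp only [map_add, map_sub, map_pow, map_ofNat, hbAval]
  rintro ⟨x, y, h⟩
  exact key ⟨x, y, by rw [hm, he]; exact h⟩

set_option maxHeartbeats 400000 in
/-- **`u₊ = (−1 + 2θ + 2θ²) + √2(−1 + 2θ + θ²)` is not the square of an INTEGER of `A₁ = ℚ(θ) ⊔ ℚ_1`**: `u₊ = −1 + 2θ + 2θ² + ξ(−2 + 3θ + 3θ²)`
with `ξ = √2/θ`, `u₊ − 1 = ξ²(1 + ξλ₁)` and `u₊ − (1 + ξ² + ξ³θ²) = ξ⁴(1 + ξλ₂)`, so `u₊` is in neither class of unit squares modulo `ξ⁵` (tree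
`not_exists_sq_eq_of_not_pow_five_dvd`, `e = 2`, `f = 1`). KERNEL. [cite: Omeara1963, §63A (63:1a)] -/
theorem not_exists_sq_eq_uplus_sup_layer_one_d316
    (hθ : aeval θ (Cubic.toPoly ⟨1, ((-1 : ℤ) : ℚ), ((-4 : ℤ) : ℚ), ((2 : ℤ) : ℚ)⟩) = 0)
    {t : AlgebraicClosure ℚ} (ht : t ∈ (CyclotomicZp.zpExtension 2).layer 1) (ht2 : t ^ 2 = 2) :
    haveI : FiniteDimensional ℚ ↥ℚ⟮θ⟯ :=
      IntermediateField.adjoin.finiteDimensional ⟨_, Cubic.monic_of_a_eq_one', by rwa [← aeval_def]⟩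
    haveI : FiniteDimensional ℚ ↥((CyclotomicZp.zpExtension 2).layer 1) := (CyclotomicZp.zpExtension 2).finiteDimensional_layer_holds 1
    ¬ ∃ c : 𝓞 ↥(ℚ⟮θ⟯ ⊔ (CyclotomicZp.zpExtension 2).layer 1),
      ((c : 𝓞 ↥(ℚ⟮θ⟯ ⊔ (CyclotomicZp.zpExtension 2).layer 1)) : ↥(ℚ⟮θ⟯ ⊔ (CyclotomicZp.zpExtension 2).layer 1)) ^ 2 =
        inclusion (le_sup_left : ℚ⟮θ⟯ ≤ ℚ⟮θ⟯ ⊔ (CyclotomicZp.zpExtension 2).layer 1)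
            (-1 + 2 * AdjoinSimple.gen ℚ θ + 2 * AdjoinSimple.gen ℚ θ ^ 2) +
          ⟨t, (le_sup_right : (CyclotomicZp.zpExtension 2).layer 1 ≤ _) ht⟩ *
            inclusion (le_sup_left : ℚ⟮θ⟯ ≤ ℚ⟮θ⟯ ⊔ (CyclotomicZp.zpExtension 2).layer 1)
              (-1 + 2 * AdjoinSimple.gen ℚ θ + AdjoinSimple.gen ℚ θ ^ 2) := by
  haveI : FiniteDimensional ℚ ↥ℚ⟮θ⟯ :=
    IntermediateField.adjoin.finiteDimensional ⟨_, Cubic.monic_of_a_eq_one', by rwa [← aeval_def]⟩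
  haveI : FiniteDimensional ℚ ↥((CyclotomicZp.zpExtension 2).layer 1) := (CyclotomicZp.zpExtension 2).finiteDimensional_layer_holds 1
  haveI : NumberField ↥ℚ⟮θ⟯ := NumberField.mk
  haveI : NumberField ↥(ℚ⟮θ⟯ ⊔ (CyclotomicZp.zpExtension 2).layer 1) := NumberField.mk
  obtain ⟨bA, xA, sA, -, hbAval, hsAval, -, RbA, RxA, hs, -, hprime, hres, hnb2, -, -, -, -, -⟩ :=
    layer_one_dyadic_d316 hθ ht ht2
  obtain ⟨htwo, -, -, -, -, -, hu1, huq, hu0, -, -, -, -, -⟩ := layer_one_ids_d316 bA xA RbA RxA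
  have h2 : (2 : 𝓞 ↥(ℚ⟮θ⟯ ⊔ (CyclotomicZp.zpExtension 2).layer 1)) = xA ^ 2 * bA ^ 2 := htwo.symm
  have hone : ∀ (z : 𝓞 ↥(ℚ⟮θ⟯ ⊔ (CyclotomicZp.zpExtension 2).layer 1)) (n : ℕ), ¬ xA ^ (n + 1) ∣ 1 + xA * z := by
    rintro z n hdvd
    obtain ⟨c, hc⟩ := (dvd_pow_self xA (Nat.succ_ne_zero n)).trans hdvd
    exact hprime.not_unit (isUnit_of_dvd_one ⟨c - z, by linear_combination hc⟩)
  set U : 𝓞 ↥(ℚ⟮θ⟯ ⊔ (CyclotomicZp.zpExtension 2).layer 1) := -1 + 2 * bA + 2 * bA ^ 2 + xA * (-2 + 3 * bA + 3 * bA ^ 2) with hUdef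
  have hu : ¬ xA ∣ U := by
    rintro ⟨c, hc⟩
    exact hprime.not_unit (isUnit_of_dvd_one ⟨c - (-2 - 4 * xA + 3 * bA + 6 * bA * xA + 3 * bA ^ 2 + 5 * bA ^ 2 * xA),
      by linear_combination hc - hu0⟩)
  have h1 : ¬ xA ^ 5 ∣ U - 1 := by
    intro hdvd
    rw [hu1, show xA ^ 5 = xA ^ 2 * xA ^ 3 by ring] at hdvd
    exact hone _ 2 ((mul_dvd_mul_iff_left (pow_ne_zero 2 hprime.ne_zero)).mp hdvd)
  have hq : ¬ xA ^ 5 ∣ U - (1 + xA ^ 2 + xA ^ 3 * bA ^ 2) := by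
    intro hdvd
    rw [huq, show xA ^ 5 = xA ^ 4 * xA ^ 1 by ring] at hdvd
    exact hone _ 0 ((mul_dvd_mul_iff_left (pow_ne_zero 4 hprime.ne_zero)).mp hdvd)
  have key := not_exists_sq_eq_of_not_pow_five_dvd h2 hnb2 hres hu h1 hq
  -- the value of `U`
  have hθ'rel : (bA : ↥(ℚ⟮θ⟯ ⊔ (CyclotomicZp.zpExtension 2).layer 1)) ^ 3 - (bA : ↥(ℚ⟮θ⟯ ⊔ (CyclotomicZp.zpExtension 2).layer 1)) ^ 2 -
      4 * (bA : ↥(ℚ⟮θ⟯ ⊔ (CyclotomicZp.zpExtension 2).layer 1)) + 2 = 0 := by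
    have h := congrArg (algebraMap (𝓞 ↥(ℚ⟮θ⟯ ⊔ (CyclotomicZp.zpExtension 2).layer 1)) ↥(ℚ⟮θ⟯ ⊔ (CyclotomicZp.zpExtension 2).layer 1)) RbA
    simp only [map_add, map_sub, map_mul, map_pow, map_ofNat, map_zero] at h; exact h
  have hsx : (xA : ↥(ℚ⟮θ⟯ ⊔ (CyclotomicZp.zpExtension 2).layer 1)) * (bA : ↥(ℚ⟮θ⟯ ⊔ (CyclotomicZp.zpExtension 2).layer 1)) =
      ⟨t, (le_sup_right : (CyclotomicZp.zpExtension 2).layer 1 ≤ _) ht⟩ := by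
    rw [← hsAval, ← hs]; push_cast; ring
  have hU : ((U : 𝓞 ↥(ℚ⟮θ⟯ ⊔ (CyclotomicZp.zpExtension 2).layer 1)) : ↥(ℚ⟮θ⟯ ⊔ (CyclotomicZp.zpExtension 2).layer 1)) =
      inclusion (le_sup_left : ℚ⟮θ⟯ ≤ ℚ⟮θ⟯ ⊔ (CyclotomicZp.zpExtension 2).layer 1)
          (-1 + 2 * AdjoinSimple.gen ℚ θ + 2 * AdjoinSimple.gen ℚ θ ^ 2) +
        ⟨t, (le_sup_right : (CyclotomicZp.zpExtension 2).layer 1 ≤ _) ht⟩ *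
          inclusion (le_sup_left : ℚ⟮θ⟯ ≤ ℚ⟮θ⟯ ⊔ (CyclotomicZp.zpExtension 2).layer 1)
            (-1 + 2 * AdjoinSimple.gen ℚ θ + AdjoinSimple.gen ℚ θ ^ 2) := by
    rw [hUdef, ← hsx]
    simp only [map_add, map_mul, map_pow, map_neg, map_one, map_ofNat, ← hbAval]
    linear_combination (-(xA : ↥(ℚ⟮θ⟯ ⊔ (CyclotomicZp.zpExtension 2).layer 1))) * hθ'rel
  rintro ⟨c, hc⟩
  refine key ⟨c, ?_⟩
  apply NumberField.RingOfIntegers.coe_injective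
  rw [map_pow, ← NumberField.RingOfIntegers.coe_eq_algebraMap, ← NumberField.RingOfIntegers.coe_eq_algebraMap, hc, hU]

/-- **`u₊` is not the square of a UNIT of `A₁`** (unit form of the previous statement, for the `#(U⁺/U²)` count).
[cite: Omeara1963, §63A (63:1a)] [cite: FrohlichTaylor1990, Ch. V §1 (1.12), p. 164] -/
theorem not_exists_unit_sq_eq_uplus_sup_layer_one_d316
    (hθ : aeval θ (Cubic.toPoly ⟨1, ((-1 : ℤ) : ℚ), ((-4 : ℤ) : ℚ), ((2 : ℤ) : ℚ)⟩) = 0)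
    {t : AlgebraicClosure ℚ} (ht : t ∈ (CyclotomicZp.zpExtension 2).layer 1) (ht2 : t ^ 2 = 2)
    (e : haveI : FiniteDimensional ℚ ↥ℚ⟮θ⟯ :=
        IntermediateField.adjoin.finiteDimensional ⟨_, Cubic.monic_of_a_eq_one', by rwa [← aeval_def]⟩
      haveI : FiniteDimensional ℚ ↥((CyclotomicZp.zpExtension 2).layer 1) :=
        (CyclotomicZp.zpExtension 2).finiteDimensional_layer_holds 1
      (𝓞 ↥(ℚ⟮θ⟯ ⊔ (CyclotomicZp.zpExtension 2).layer 1))ˣ)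
    (he : ((e : 𝓞 ↥(ℚ⟮θ⟯ ⊔ (CyclotomicZp.zpExtension 2).layer 1)) : ↥(ℚ⟮θ⟯ ⊔ (CyclotomicZp.zpExtension 2).layer 1)) =
      inclusion (le_sup_left : ℚ⟮θ⟯ ≤ ℚ⟮θ⟯ ⊔ (CyclotomicZp.zpExtension 2).layer 1)
          (-1 + 2 * AdjoinSimple.gen ℚ θ + 2 * AdjoinSimple.gen ℚ θ ^ 2) +
        ⟨t, (le_sup_right : (CyclotomicZp.zpExtension 2).layer 1 ≤ _) ht⟩ *
          inclusion (le_sup_left : ℚ⟮θ⟯ ≤ ℚ⟮θ⟯ ⊔ (CyclotomicZp.zpExtension 2).layer 1)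
            (-1 + 2 * AdjoinSimple.gen ℚ θ + AdjoinSimple.gen ℚ θ ^ 2)) :
    ¬ ∃ w : (𝓞 ↥(ℚ⟮θ⟯ ⊔ (CyclotomicZp.zpExtension 2).layer 1))ˣ, e = w ^ 2 := by
  rintro ⟨w, hw⟩
  refine not_exists_sq_eq_uplus_sup_layer_one_d316 hθ ht ht2 ⟨(w : 𝓞 ↥(ℚ⟮θ⟯ ⊔ (CyclotomicZp.zpExtension 2).layer 1)), ?_⟩
  rw [← he, hw, Units.val_pow_eq_pow_val]; push_cast; ring

set_option maxHeartbeats 400000 in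
/-- **`u₊(2 + √2)` is not the square of an integer of `A₁`**: `2 + √2 = ξμ` with `ξ` prime, `ξ ∤ u₊`, `ξ ∤ μ`; from `c² = u₊ξμ`, `ξ ∣ c` and then
`ξ ∣ u₊μ`.  (For the second layer `A₂ = A₁(η)`, `η² = 2 + √2`: together with the previous statement this excludes `u₊ ∈ A₂²` — a square root `w`
would have `τw = ±w` for `Gal(A₂/A₁) = ⟨τ⟩`.) [cite: Omeara1963, §63A] -/
theorem not_exists_sq_eq_uplus_mul_sup_layer_one_d316
    (hθ : aeval θ (Cubic.toPoly ⟨1, ((-1 : ℤ) : ℚ), ((-4 : ℤ) : ℚ), ((2 : ℤ) : ℚ)⟩) = 0)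
    {t : AlgebraicClosure ℚ} (ht : t ∈ (CyclotomicZp.zpExtension 2).layer 1) (ht2 : t ^ 2 = 2) :
    haveI : FiniteDimensional ℚ ↥ℚ⟮θ⟯ :=
      IntermediateField.adjoin.finiteDimensional ⟨_, Cubic.monic_of_a_eq_one', by rwa [← aeval_def]⟩
    haveI : FiniteDimensional ℚ ↥((CyclotomicZp.zpExtension 2).layer 1) := (CyclotomicZp.zpExtension 2).finiteDimensional_layer_holds 1
    ¬ ∃ c : 𝓞 ↥(ℚ⟮θ⟯ ⊔ (CyclotomicZp.zpExtension 2).layer 1),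
      ((c : 𝓞 ↥(ℚ⟮θ⟯ ⊔ (CyclotomicZp.zpExtension 2).layer 1)) : ↥(ℚ⟮θ⟯ ⊔ (CyclotomicZp.zpExtension 2).layer 1)) ^ 2 =
        (inclusion (le_sup_left : ℚ⟮θ⟯ ≤ ℚ⟮θ⟯ ⊔ (CyclotomicZp.zpExtension 2).layer 1)
            (-1 + 2 * AdjoinSimple.gen ℚ θ + 2 * AdjoinSimple.gen ℚ θ ^ 2) +
          ⟨t, (le_sup_right : (CyclotomicZp.zpExtension 2).layer 1 ≤ _) ht⟩ *
            inclusion (le_sup_left : ℚ⟮θ⟯ ≤ ℚ⟮θ⟯ ⊔ (CyclotomicZp.zpExtension 2).layer 1)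
              (-1 + 2 * AdjoinSimple.gen ℚ θ + AdjoinSimple.gen ℚ θ ^ 2)) *
        (2 + ⟨t, (le_sup_right : (CyclotomicZp.zpExtension 2).layer 1 ≤ _) ht⟩) := by
  haveI : FiniteDimensional ℚ ↥ℚ⟮θ⟯ :=
    IntermediateField.adjoin.finiteDimensional ⟨_, Cubic.monic_of_a_eq_one', by rwa [← aeval_def]⟩
  haveI : FiniteDimensional ℚ ↥((CyclotomicZp.zpExtension 2).layer 1) := (CyclotomicZp.zpExtension 2).finiteDimensional_layer_holds 1
  haveI : NumberField ↥ℚ⟮θ⟯ := NumberField.mk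
  haveI : NumberField ↥(ℚ⟮θ⟯ ⊔ (CyclotomicZp.zpExtension 2).layer 1) := NumberField.mk
  obtain ⟨bA, xA, sA, -, hbAval, hsAval, -, RbA, RxA, hs, -, hprime, -, -, hnμ, -, -, -, -⟩ :=
    layer_one_dyadic_d316 hθ ht ht2
  obtain ⟨-, -, -, hxmu, -, -, -, -, hu0, -, -, -, -, -⟩ := layer_one_ids_d316 bA xA RbA RxA
  set U : 𝓞 ↥(ℚ⟮θ⟯ ⊔ (CyclotomicZp.zpExtension 2).layer 1) := -1 + 2 * bA + 2 * bA ^ 2 + xA * (-2 + 3 * bA + 3 * bA ^ 2) with hUdef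
  have hu : ¬ xA ∣ U := by
    rintro ⟨c, hc⟩
    exact hprime.not_unit (isUnit_of_dvd_one ⟨c - (-2 - 4 * xA + 3 * bA + 6 * bA * xA + 3 * bA ^ 2 + 5 * bA ^ 2 * xA),
      by linear_combination hc - hu0⟩)
  -- the values
  have hθ'rel : (bA : ↥(ℚ⟮θ⟯ ⊔ (CyclotomicZp.zpExtension 2).layer 1)) ^ 3 - (bA : ↥(ℚ⟮θ⟯ ⊔ (CyclotomicZp.zpExtension 2).layer 1)) ^ 2 -
      4 * (bA : ↥(ℚ⟮θ⟯ ⊔ (CyclotomicZp.zpExtension 2).layer 1)) + 2 = 0 := by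
    have h := congrArg (algebraMap (𝓞 ↥(ℚ⟮θ⟯ ⊔ (CyclotomicZp.zpExtension 2).layer 1)) ↥(ℚ⟮θ⟯ ⊔ (CyclotomicZp.zpExtension 2).layer 1)) RbA
    simp only [map_add, map_sub, map_mul, map_pow, map_ofNat, map_zero] at h; exact h
  have hsx : (xA : ↥(ℚ⟮θ⟯ ⊔ (CyclotomicZp.zpExtension 2).layer 1)) * (bA : ↥(ℚ⟮θ⟯ ⊔ (CyclotomicZp.zpExtension 2).layer 1)) =
      ⟨t, (le_sup_right : (CyclotomicZp.zpExtension 2).layer 1 ≤ _) ht⟩ := by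
    rw [← hsAval, ← hs]; push_cast; ring
  have hUm : (((U * (xA * (bA + bA ^ 2 * xA))) : 𝓞 ↥(ℚ⟮θ⟯ ⊔ (CyclotomicZp.zpExtension 2).layer 1)) :
        ↥(ℚ⟮θ⟯ ⊔ (CyclotomicZp.zpExtension 2).layer 1)) =
      (inclusion (le_sup_left : ℚ⟮θ⟯ ≤ ℚ⟮θ⟯ ⊔ (CyclotomicZp.zpExtension 2).layer 1)
          (-1 + 2 * AdjoinSimple.gen ℚ θ + 2 * AdjoinSimple.gen ℚ θ ^ 2) +
        ⟨t, (le_sup_right : (CyclotomicZp.zpExtension 2).layer 1 ≤ _) ht⟩ *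
          inclusion (le_sup_left : ℚ⟮θ⟯ ≤ ℚ⟮θ⟯ ⊔ (CyclotomicZp.zpExtension 2).layer 1)
            (-1 + 2 * AdjoinSimple.gen ℚ θ + AdjoinSimple.gen ℚ θ ^ 2)) *
        (2 + ⟨t, (le_sup_right : (CyclotomicZp.zpExtension 2).layer 1 ≤ _) ht⟩) := by
    rw [hxmu, hUdef, ← hsx]
    simp only [map_add, map_mul, map_pow, map_neg, map_one, map_ofNat, ← hbAval]
    linear_combination (-(xA : ↥(ℚ⟮θ⟯ ⊔ (CyclotomicZp.zpExtension 2).layer 1)) *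
      (2 + (xA : ↥(ℚ⟮θ⟯ ⊔ (CyclotomicZp.zpExtension 2).layer 1)) * (bA : ↥(ℚ⟮θ⟯ ⊔ (CyclotomicZp.zpExtension 2).layer 1)))) * hθ'rel
  rintro ⟨c, hc⟩
  have hc' : c ^ 2 = U * (xA * (bA + bA ^ 2 * xA)) := by
    apply NumberField.RingOfIntegers.coe_injective
    rw [map_pow, ← NumberField.RingOfIntegers.coe_eq_algebraMap, ← NumberField.RingOfIntegers.coe_eq_algebraMap, hc, hUm]
  -- `ξ ∣ c`, then `ξ ∣ u₊ μ`
  have hxc : xA ∣ c := hprime.dvd_of_dvd_pow (n := 2) ⟨U * (bA + bA ^ 2 * xA), by rw [hc']; ring⟩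
  obtain ⟨d, rfl⟩ := hxc
  have h3 : xA * (xA * d ^ 2) = xA * (U * (bA + bA ^ 2 * xA)) := by linear_combination hc'
  have h4 : xA ∣ U * (bA + bA ^ 2 * xA) := ⟨d ^ 2, (mul_left_cancel₀ hprime.ne_zero h3).symm⟩
  rcases hprime.dvd_or_dvd h4 with h | h
  · exact hu h
  · exact hnμ h

end Summit.BirchSwinnertonDyer.BirchSwinnertonDyer.Theorems.AddKatoTwo

end
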